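import Summits.Ventures.HodgeRepro2.T5SU11KernelCompositionAnalytic
import Summits.Ventures.HodgeRepro2.T5SU11ResolventIterateAnalytic
import Mathlib.Analysis.Analytic.Uniqueness
import Mathlib.Analysis.SpecificLimits.Normed

/-!
# The Taylor series of the composed kernels and of the powers of the resolvent converge on the SHARP disc
`|μ − μ₂| < (λ₂ − 1)²`

Rows 589/590 give the Taylor series `K_μ^{∘(n+1)} = Σ_k C(n+k, k) (μ − μ₂)^k K_{μ₂}^{∘(n+k+1)}` and
`(G^I_μ)^{n+1} g = Σ_k C(n+k, k) (μ − μ₂)^k (G^I_{μ₂})^{n+k+1} g` near `μ₂`. Here they are shown to converge on the whole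
sharp disc `|μ − μ₂| < (λ₂ − 1)² = μ₂ + 1` — the largest disc about `μ₂` inside the half-line `(−1, ∞)` of analyticity:

* `hasFPowerSeriesOnBall_of_analyticOnNhd` — **the abstract step**: a function analytic on `(μ₂ − r, μ₂ + r)` whose Taylor
  series at `μ₂` has coefficients `|c_k| r^k ≤ A C(n+k, k)` has that series on the ball of radius `r` (the series sums
  to an analytic function on the ball — radius by the binomial series `Σ C(n+k, k) θ^k` — which agrees with the
  function near `μ₂`, hence on the ball by the identity theorem);
* `kernel_comp_hasFPowerSeriesOnBall`, `kernel_comp_hasSum` — **`K_λ^{∘(n+1)}(t, s) = Σ_k (μ − μ₂)^k C(n+k, k) K_{λ₂}^{∘(n+k+1)}(t, s)`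
  on the sharp disc** (the coefficient bounds from row 557's sharp `W_1` constants);
* `iterate_hasFPowerSeriesOnBall`, `iterate_hasSum` — **`(G^I_λ)^{n+1} g(t) = Σ_k (μ − μ₂)^k C(n+k, k) (G^I_{λ₂})^{n+k+1} g(t)`
  on the sharp disc**, `g ∈ W_1`.

Rows 577 and 559 are the cases `n = 0`. Nothing is claimed about (N).

Blind lane: Mathlib + the HodgeRepro2 prefix only; no sorry; axioms ⊆ {propext, Classical.choice,
Quot.sound}.
-/

namespace Summit.Ventures.HodgeRepro2.T5SU11KernelCompositionSharpDisc

open Filter Topology MeasureTheory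
open Set (Ioi Ioc Ioo)
open T5SU11Cartan T5SU11SphericalFunction T5SU11SphericalDecay T5SU11RadialGreenKernel T5SU11RadialGreenImproper
  T5SU11ResolventDerivativeMu T5SU11KernelDifferenceRegularity T5SU11KernelDerivative T5SU11WeightedSpaceGroundState
  T5SU11KernelAnalytic T5SU11KernelCompositionAnalytic T5SU11ResolventIterateAnalytic

/-- **The abstract step**: a real function analytic on `(μ₂ − r, μ₂ + r)` whose Taylor series at `μ₂` has the
coefficients `c_k` with `|c_k| r^k ≤ A C(n+k, k)` has that power series on the ball of radius `r` about `μ₂`. -/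
theorem hasFPowerSeriesOnBall_of_analyticOnNhd {f : ℝ → ℝ} {c : ℕ → ℝ} {μ₂ r A : ℝ} (n : ℕ) (hr : 0 < r)
    (hf : AnalyticOnNhd ℝ f (Ioo (μ₂ - r) (μ₂ + r)))
    (hp : HasFPowerSeriesAt f (FormalMultilinearSeries.ofScalars ℝ c) μ₂)
    (hc : ∀ k, |c k| * r ^ k ≤ A * ((n + k).choose k : ℝ)) :
    HasFPowerSeriesOnBall f (FormalMultilinearSeries.ofScalars ℝ c) μ₂ (ENNReal.ofReal r) := by
  -- the radius of the series is at least `r`: `Σ |c_k| ρ^k ≤ A Σ C(n+k, k) (ρ/r)^k < ∞` for every `ρ < r`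
  have hrad : ENNReal.ofReal r ≤ (FormalMultilinearSeries.ofScalars ℝ c).radius := by
    refine ENNReal.le_of_forall_nnreal_lt fun ρ hρ => ?_
    have hρr : (ρ : ℝ) < r := by
      rw [ENNReal.ofReal_eq_coe_nnreal hr.le, ENNReal.coe_lt_coe] at hρ
      have := NNReal.coe_lt_coe.mpr hρ
      simpa using this
    have hρ0 : (0 : ℝ) ≤ ρ := ρ.2
    obtain ⟨θ, hθ0, hθ1, hρθ⟩ : ∃ θ : ℝ, 0 ≤ θ ∧ θ < 1 ∧ (ρ : ℝ) = r * θ :=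
      ⟨(ρ : ℝ) / r, div_nonneg hρ0 hr.le, (div_lt_one hr).mpr hρr, by rw [mul_div_cancel₀ _ hr.ne']⟩
    have hsum : Summable fun k : ℕ => A * (((k + n).choose n : ℝ) * θ ^ k) :=
      (summable_choose_mul_geometric_of_norm_lt_one n
        (by rwa [Real.norm_eq_abs, abs_of_nonneg hθ0])).mul_left A
    refine (FormalMultilinearSeries.ofScalars ℝ c).le_radius_of_summable_norm
      (Summable.of_nonneg_of_le (fun k => ?_) (fun k => ?_) hsum)
    · exact mul_nonneg (norm_nonneg _) (pow_nonneg hρ0 _)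
    · rw [FormalMultilinearSeries.ofScalars_norm, Real.norm_eq_abs, hρθ, mul_pow, ← mul_assoc]
      have hck : ((n + k).choose k : ℝ) = ((k + n).choose n : ℝ) := by
        rw [add_comm n k, Nat.choose_symm_add]
      calc |c k| * r ^ k * θ ^ k ≤ A * ((n + k).choose k : ℝ) * θ ^ k :=
            mul_le_mul_of_nonneg_right (hc k) (pow_nonneg hθ0 _)
        _ = A * (((k + n).choose n : ℝ) * θ ^ k) := by rw [hck]; ring
  have hpos : 0 < (FormalMultilinearSeries.ofScalars ℝ c).radius :=
    lt_of_lt_of_le (ENNReal.ofReal_pos.mpr hr) hrad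
  -- the sum of the series, as a function on the ball about `μ₂`
  have hg : HasFPowerSeriesOnBall (fun z => (FormalMultilinearSeries.ofScalars ℝ c).sum (z - μ₂))
      (FormalMultilinearSeries.ofScalars ℝ c) μ₂ (ENNReal.ofReal r) := by
    have h := (((FormalMultilinearSeries.ofScalars ℝ c).hasFPowerSeriesOnBall hpos).mono
      (ENNReal.ofReal_pos.mpr hr) hrad).comp_sub μ₂
    rwa [zero_add] at h
  -- `f` and the sum agree near `μ₂` (the same series), hence on the ball (identity theorem)
  have hfg : f =ᶠ[𝓝 μ₂] fun z => (FormalMultilinearSeries.ofScalars ℝ c).sum (z - μ₂) := by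
    have h1 := hp.eventually_hasSum
    have h2 := hg.hasFPowerSeriesAt.eventually_hasSum
    have h3 : ∀ᶠ y : ℝ in 𝓝 0, f (μ₂ + y) = (FormalMultilinearSeries.ofScalars ℝ c).sum (μ₂ + y - μ₂) :=
      (h1.and h2).mono fun y hy => hy.1.unique hy.2
    have ht : Tendsto (fun z : ℝ => z - μ₂) (𝓝 μ₂) (𝓝 0) := tendsto_sub_nhds_zero_iff.mpr tendsto_id
    filter_upwards [ht.eventually h3] with z hz
    simpa only [add_sub_cancel] using hz
  have hU : IsPreconnected (Metric.ball μ₂ r) := (convex_ball μ₂ r).isPreconnected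
  have hf' : AnalyticOnNhd ℝ f (Metric.ball μ₂ r) := by rwa [Real.ball_eq_Ioo]
  have hg' : AnalyticOnNhd ℝ (fun z => (FormalMultilinearSeries.ofScalars ℝ c).sum (z - μ₂)) (Metric.ball μ₂ r) := by
    have h := hg.analyticOnNhd
    rwa [Metric.eball_ofReal] at h
  have heq : Set.EqOn (fun z => (FormalMultilinearSeries.ofScalars ℝ c).sum (z - μ₂)) f (Metric.ball μ₂ r) :=
    hg'.eqOn_of_preconnected_of_eventuallyEq hf' hU (Metric.mem_ball_self hr) hfg.symm
  refine hg.congr ?_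
  rwa [Metric.eball_ofReal]

/-- `μ₂ − (λ₂ − 1)² = −1` for `μ₂ = λ₂(λ₂ − 2)`: the sharp disc is the largest disc about `μ₂` inside `(−1, ∞)`. -/
theorem Ioo_subset_Ioi (lam₂ : ℝ) :
    Ioo (lam₂ * (lam₂ - 2) - (lam₂ - 1) ^ 2) (lam₂ * (lam₂ - 2) + (lam₂ - 1) ^ 2) ⊆ Ioi (-1) := by
  intro μ hμ
  have h := hμ.1
  have e : lam₂ * (lam₂ - 2) - (lam₂ - 1) ^ 2 = -1 := by ring
  rw [e] at h
  exact h

section measure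

variable [MeasurableSpace Circle] [BorelSpace Circle]

variable {lam₂ : ℝ} (hlam₂ : 1 < lam₂)

section kernel

variable {s : ℝ} (hs : 0 < s)

include hlam₂ hs in
/-- **THE TAYLOR SERIES OF THE COMPOSED KERNELS CONVERGES ON THE SHARP DISC**: `μ ↦ K_{λ(μ)}^{∘(n+1)}(t, s)` has the power
series `Σ_k C(n+k, k) K_{λ₂}^{∘(n+k+1)}(t, s) (μ − μ₂)^k` on the ball of radius `(λ₂ − 1)²` about `μ₂ = λ₂(λ₂ − 2)`. -/
theorem kernel_comp_hasFPowerSeriesOnBall (n : ℕ) {t : ℝ} (ht : 0 < t) :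
    HasFPowerSeriesOnBall (fun μ => ((greenSolI (fun t => sph (1 + Real.sqrt (μ + 1)) (hyp t))
        (sphDecay (1 + Real.sqrt (μ + 1))))^[n] (fun r => sphGreenKernel (1 + Real.sqrt (μ + 1)) r s)) t)
      (FormalMultilinearSeries.ofScalars ℝ (fun k => ((n + k).choose k : ℝ)
        * ((greenSolI (fun t => sph lam₂ (hyp t)) (sphDecay lam₂))^[n + k] (fun r => sphGreenKernel lam₂ r s)) t))
      (lam₂ * (lam₂ - 2)) (ENNReal.ofReal ((lam₂ - 1) ^ 2)) := by
  have hμ₂ : -1 < lam₂ * (lam₂ - 2) := by nlinarith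
  have hr : 0 < (lam₂ - 1) ^ 2 := by
    have : 0 < lam₂ - 1 := by linarith
    positivity
  obtain ⟨D, _, hD⟩ := kernel_source_mem_weighted_one hlam₂ hs
  have hg := kernel_source_continuousOn hlam₂ hs
  -- the Taylor series at `μ₂` (row 589), with the coefficients written at `λ₂`
  have hp := kernel_comp_hasFPowerSeriesAt hs n hμ₂ ht
  rw [one_add_sqrt_eq hlam₂] at hp
  refine hasFPowerSeriesOnBall_of_analyticOnNhd (A := D * sph 1 (hyp t) / ((lam₂ - 1) ^ 2) ^ n) n hr
    ((kernel_comp_analyticOnNhd_mu hs n ht).mono (Ioo_subset_Ioi lam₂)) hp fun k => ?_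
  -- the coefficient bound from the sharp `W_1` constants of the iterates (row 557)
  have hb := (iterate_mem_weighted_one hlam₂ hg hD (n + k)).2 t ht
  rw [abs_mul, abs_of_nonneg (Nat.cast_nonneg _)]
  have hpk : 0 < ((lam₂ - 1) ^ 2) ^ k := pow_pos hr _
  have hpn : 0 < ((lam₂ - 1) ^ 2) ^ n := pow_pos hr _
  calc ((n + k).choose k : ℝ)
        * |((greenSolI (fun t => sph lam₂ (hyp t)) (sphDecay lam₂))^[n + k] (fun r => sphGreenKernel lam₂ r s)) t|
        * ((lam₂ - 1) ^ 2) ^ k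
      ≤ ((n + k).choose k : ℝ) * (D * sph 1 (hyp t) / ((lam₂ - 1) ^ 2) ^ (n + k)) * ((lam₂ - 1) ^ 2) ^ k := by
        gcongr
    _ = D * sph 1 (hyp t) / ((lam₂ - 1) ^ 2) ^ n * ((n + k).choose k : ℝ) := by
        rw [pow_add]
        field_simp

include hlam₂ hs in
/-- **`K_λ^{∘(n+1)}(t, s) = Σ_k (μ − μ₂)^k C(n+k, k) K_{λ₂}^{∘(n+k+1)}(t, s)` on the sharp disc `|μ − μ₂| < (λ₂ − 1)²`**. -/
theorem kernel_comp_hasSum {lam : ℝ} (hlam : 1 < lam)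
    (hq : |lam * (lam - 2) - lam₂ * (lam₂ - 2)| < (lam₂ - 1) ^ 2) (n : ℕ) {t : ℝ} (ht : 0 < t) :
    HasSum (fun k : ℕ => (lam * (lam - 2) - lam₂ * (lam₂ - 2)) ^ k * (((n + k).choose k : ℝ)
        * ((greenSolI (fun t => sph lam₂ (hyp t)) (sphDecay lam₂))^[n + k] (fun r => sphGreenKernel lam₂ r s)) t))
      (((greenSolI (fun t => sph lam (hyp t)) (sphDecay lam))^[n] (fun r => sphGreenKernel lam r s)) t) := by
  have hr : 0 < (lam₂ - 1) ^ 2 := by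
    have : 0 < lam₂ - 1 := by linarith
    positivity
  have hy : lam * (lam - 2) - lam₂ * (lam₂ - 2) ∈ Metric.eball (0 : ℝ) (ENNReal.ofReal ((lam₂ - 1) ^ 2)) := by
    rw [Metric.mem_eball, edist_dist, dist_zero_right, Real.norm_eq_abs, ENNReal.ofReal_lt_ofReal_iff hr]
    exact hq
  have h := (kernel_comp_hasFPowerSeriesOnBall hlam₂ hs n ht).hasSum hy
  simp only [FormalMultilinearSeries.ofScalars_apply_eq, smul_eq_mul] at h
  rw [show lam₂ * (lam₂ - 2) + (lam * (lam - 2) - lam₂ * (lam₂ - 2)) = lam * (lam - 2) by ring,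
    one_add_sqrt_eq hlam] at h
  exact h.congr_fun fun k => by ring

end kernel

section ground_state

variable {g : ℝ → ℝ} (hg : ContinuousOn g (Ioi 0)) {D : ℝ} (hD : ∀ s, 0 < s → |g s| ≤ D * sph 1 (hyp s))

include hlam₂ hg hD in
/-- **THE TAYLOR SERIES OF THE POWERS OF THE RESOLVENT CONVERGES ON THE SHARP DISC**: `μ ↦ (G^I_{λ(μ)})^{n+1} g(t)`, `g ∈ W_1`,
has the power series `Σ_k C(n+k, k) (G^I_{λ₂})^{n+k+1} g(t) (μ − μ₂)^k` on the ball of radius `(λ₂ − 1)²` about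
`μ₂ = λ₂(λ₂ − 2)`. -/
theorem iterate_hasFPowerSeriesOnBall (n : ℕ) {t : ℝ} (ht : 0 < t) :
    HasFPowerSeriesOnBall (fun μ => ((greenSolI (fun t => sph (1 + Real.sqrt (μ + 1)) (hyp t))
        (sphDecay (1 + Real.sqrt (μ + 1))))^[n + 1] g) t)
      (FormalMultilinearSeries.ofScalars ℝ (fun k => ((n + k).choose k : ℝ)
        * ((greenSolI (fun t => sph lam₂ (hyp t)) (sphDecay lam₂))^[n + k + 1] g) t))
      (lam₂ * (lam₂ - 2)) (ENNReal.ofReal ((lam₂ - 1) ^ 2)) := by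
  have hμ₂ : -1 < lam₂ * (lam₂ - 2) := by nlinarith
  have hr : 0 < (lam₂ - 1) ^ 2 := by
    have : 0 < lam₂ - 1 := by linarith
    positivity
  have hp := iterate_hasFPowerSeriesAt hg hD n hμ₂ ht
  rw [one_add_sqrt_eq hlam₂] at hp
  refine hasFPowerSeriesOnBall_of_analyticOnNhd (A := D * sph 1 (hyp t) / ((lam₂ - 1) ^ 2) ^ (n + 1)) n hr
    ((iterate_analyticOnNhd_mu hg hD n ht).mono (Ioo_subset_Ioi lam₂)) hp fun k => ?_
  have hb := (iterate_mem_weighted_one hlam₂ hg hD (n + k + 1)).2 t ht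
  rw [abs_mul, abs_of_nonneg (Nat.cast_nonneg _)]
  have hpk : 0 < ((lam₂ - 1) ^ 2) ^ k := pow_pos hr _
  have hpn : 0 < ((lam₂ - 1) ^ 2) ^ (n + 1) := pow_pos hr _
  calc ((n + k).choose k : ℝ) * |((greenSolI (fun t => sph lam₂ (hyp t)) (sphDecay lam₂))^[n + k + 1] g) t|
        * ((lam₂ - 1) ^ 2) ^ k
      ≤ ((n + k).choose k : ℝ) * (D * sph 1 (hyp t) / ((lam₂ - 1) ^ 2) ^ (n + k + 1)) * ((lam₂ - 1) ^ 2) ^ k := by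
        gcongr
    _ = D * sph 1 (hyp t) / ((lam₂ - 1) ^ 2) ^ (n + 1) * ((n + k).choose k : ℝ) := by
        rw [show n + k + 1 = (n + 1) + k by ring, pow_add]
        field_simp

include hlam₂ hg hD in
/-- **`(G^I_λ)^{n+1} g(t) = Σ_k (μ − μ₂)^k C(n+k, k) (G^I_{λ₂})^{n+k+1} g(t)` on the sharp disc `|μ − μ₂| < (λ₂ − 1)²`**,
`g ∈ W_1`. -/
theorem iterate_hasSum {lam : ℝ} (hlam : 1 < lam)
    (hq : |lam * (lam - 2) - lam₂ * (lam₂ - 2)| < (lam₂ - 1) ^ 2) (n : ℕ) {t : ℝ} (ht : 0 < t) :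
    HasSum (fun k : ℕ => (lam * (lam - 2) - lam₂ * (lam₂ - 2)) ^ k * (((n + k).choose k : ℝ)
        * ((greenSolI (fun t => sph lam₂ (hyp t)) (sphDecay lam₂))^[n + k + 1] g) t))
      (((greenSolI (fun t => sph lam (hyp t)) (sphDecay lam))^[n + 1] g) t) := by
  have hr : 0 < (lam₂ - 1) ^ 2 := by
    have : 0 < lam₂ - 1 := by linarith
    positivity
  have hy : lam * (lam - 2) - lam₂ * (lam₂ - 2) ∈ Metric.eball (0 : ℝ) (ENNReal.ofReal ((lam₂ - 1) ^ 2)) := by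
    rw [Metric.mem_eball, edist_dist, dist_zero_right, Real.norm_eq_abs, ENNReal.ofReal_lt_ofReal_iff hr]
    exact hq
  have h := (iterate_hasFPowerSeriesOnBall hlam₂ hg hD n ht).hasSum hy
  simp only [FormalMultilinearSeries.ofScalars_apply_eq, smul_eq_mul] at h
  rw [show lam₂ * (lam₂ - 2) + (lam * (lam - 2) - lam₂ * (lam₂ - 2)) = lam * (lam - 2) by ring,
    one_add_sqrt_eq hlam] at h
  exact h.congr_fun fun k => by ring

end ground_state

end measure

end Summit.Ventures.HodgeRepro2.T5SU11KernelCompositionSharpDisc
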